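import Mathlib.Algebra.MvPolynomial.Funext
import Mathlib.Algebra.MvPolynomial.Monad
import Mathlib.Order.ConditionallyCompleteLattice.Finset
import HarnessLib

/-!
# The least degree `ω(Σ)` of a hypersurface through a finite set, and Cartesian products

Topic `Literature/NumberTheory/Transcendental` (trunk T-TRANSCEND). Decomposition step for the
named facts `Literature.NumberTheory.Transcendental.diaz_1989` / `Diaz1989_gridX` (`DiazLadder.lean`, `DiazGrid.lean`):
the zero-estimate side of the proofs of large transcendence degree (Philippon 1986, Diaz 1989)
is phrased through the quantity `ω(Σ)` and Philippon's "redundant variables" require its behaviour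
under Cartesian products (Nesterenko–Philippon (eds.), LNM 1752, Ch. 14, §3.2.3, Notation before
Definition 3.4 and Lemma 3.7). Here both are vendored, the lemma PROVED.

Printed statements (verbatim, LNM 1752, Ch. 14, PDF pp. 252 and 254–255).

NOTATION. For `Σ` a finite subset of `ℂ^m`, define `ω(Σ)` as the smallest total degree of a non
zero polynomial in `ℂ[z₁, …, z_m]` which vanishes on `Σ`:
`ω(Σ) = min{deg P ; P ∈ ℂ[z₁, …, z_m], P ≠ 0, P(σ) = 0 for any σ ∈ Σ}`.

LEMMA 3.7. Let `Σ₁, …, Σ_k` be finite subsets of `ℂⁿ`. Then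
`ω(Σ₁ × ⋯ × Σ_k) = min_{1 ≤ h ≤ k} ω(Σ_h)`.

(Printed proof: `≤` by pulling back a minimal polynomial for `Σ_{h₀}` to the variables of the
block `h₀`; `≥` by induction on `k`, specialising the last block. We prove `≥` by the equivalent
"peeling" argument: if `P ≠ 0` vanishes on the product and `deg P < ω(Σ_h)` for every `h`, one
frees the blocks one at a time — for fixed values of the other blocks the specialised polynomial in
the variables of block `a` has degree `< ω(Σ_a)` and vanishes on `Σ_a`, hence is `0` — so that in
the end `P` vanishes identically on `Kⁿᵏ`, and `P = 0` because the field is infinite.)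

Encodings. We work over any field `K` (infinite for Lemma 3.7) and any index types: points of
`K^σ` are functions `σ → K`, polynomials are `MvPolynomial σ K` with `MvPolynomial.eval`, the total
degree is `MvPolynomial.totalDegree`; `ω` is `omegaDeg S = sInf {deg P ; P ≠ 0 vanishing on S}`
(a genuine minimum when `S` is finite and `σ` is nonempty, `omegaDeg_spec`; the junk value `0` if no
such `P` exists). A product `Σ₁ × ⋯ × Σ_k ⊂ (Kⁿ)ᵏ = K^{ι × τ}` of sets `S h ⊆ K^τ` indexed by
`h : ι` is `piBlocks S = {z ; ∀ h, (i ↦ z (h, i)) ∈ S h}`, and `min_h` is `⨅ h, ·` (a minimum over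
the finite nonempty index type `ι`).

## Contents

* `omegaDeg`, `omegaDeg_le_totalDegree`, `exists_eval_ne_zero_of_totalDegree_lt` (the form used in
  zero estimates: a nonzero `P` with `deg P < ω(Σ)` has a non-zero value on `Σ`),
  `exists_ne_zero_forall_eval_eq_zero`, `omegaDeg_spec`, `le_omegaDeg_iff`;
* `totalDegree_bind₁_le_of_le_one` (substituting polynomials of degree `≤ 1` does not raise the
  total degree);
* `piBlocks`, `piBlocks_finite`, `omegaDeg_piBlocks_le`, `iInf_omegaDeg_le_totalDegree`, and
  **Lemma 3.7** `omegaDeg_piBlocks`.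

## References

* Yu. V. Nesterenko, P. Philippon (eds.), *Introduction to Algebraic Independence Theory*,
  LNM 1752, Springer 2001, Ch. 14 (M. Waldschmidt), §3.2.3: Notation (p. 252), Lemma 3.7 and its
  proof (pp. 254–255), Proposition 3.8 (redundant variables).
-/

noncomputable section

open MvPolynomial Finset

namespace Literature.NumberTheory.Transcendental

variable {K : Type*} [Field K] {σ : Type*}

/-- `ω(Σ)`: the least total degree of a nonzero polynomial vanishing on `Σ ⊆ K^σ`
(Nesterenko–Philippon (eds.) 2001, Ch. 14, §3.2.3, Notation, p. 252). If no nonzero polynomial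
vanishes on `Σ` (e.g. `σ` empty and `Σ ≠ ∅`, or `Σ` Zariski dense) the value is the junk `0`
(`Nat.sInf_empty`); for `Σ` finite and `σ` nonempty it is a genuine minimum (`omegaDeg_spec`).
[cite: NesterenkoPhilippon2001, Ch. 14 §3.2.3 Notation p. 252] -/
def omegaDeg (S : Set (σ → K)) : ℕ :=
  sInf {n | ∃ P : MvPolynomial σ K, P ≠ 0 ∧ (∀ x ∈ S, eval x P = 0) ∧ P.totalDegree = n}

/-- A nonzero polynomial vanishing on `Σ` has total degree `≥ ω(Σ)`. [folklore] -/
theorem omegaDeg_le_totalDegree {S : Set (σ → K)} {P : MvPolynomial σ K} (hP : P ≠ 0)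
    (hv : ∀ x ∈ S, eval x P = 0) : omegaDeg S ≤ P.totalDegree :=
  Nat.sInf_le ⟨P, hP, hv, rfl⟩

/-- The form in which `ω` is used in zero estimates: a nonzero polynomial of total degree `< ω(Σ)`
takes a nonzero value somewhere on `Σ`. [folklore] -/
theorem exists_eval_ne_zero_of_totalDegree_lt {S : Set (σ → K)} {P : MvPolynomial σ K}
    (hP : P ≠ 0) (hlt : P.totalDegree < omegaDeg S) : ∃ x ∈ S, eval x P ≠ 0 := by
  by_contra h
  push Not at h
  exact (omegaDeg_le_totalDegree hP h).not_gt hlt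

/-- Through a finite set `Σ ⊂ K^σ` (`σ` nonempty) passes a hypersurface of degree `≤ #Σ`: the
product of the linear forms `X_i - σ_i` over `σ ∈ Σ`, for any fixed coordinate `i`. [folklore] -/
theorem exists_ne_zero_forall_eval_eq_zero [Nonempty σ] {S : Set (σ → K)} (hS : S.Finite) :
    ∃ P : MvPolynomial σ K, P ≠ 0 ∧ (∀ x ∈ S, eval x P = 0) ∧
      P.totalDegree ≤ hS.toFinset.card := by
  classical
  obtain ⟨i⟩ := ‹Nonempty σ›
  refine ⟨∏ s ∈ hS.toFinset, (X i - C (s i)), ?_, ?_, ?_⟩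
  · rw [Finset.prod_ne_zero_iff]
    intro s _ h0
    have h1 := congrArg (eval fun _ => s i + 1) h0
    simp at h1
  · intro x hx
    rw [map_prod]
    exact Finset.prod_eq_zero (hS.mem_toFinset.mpr hx) (by simp)
  · refine (totalDegree_finsetProd _ _).trans ?_
    calc ∑ s ∈ hS.toFinset, (X i - C (s i) : MvPolynomial σ K).totalDegree
        ≤ ∑ _s ∈ hS.toFinset, 1 := Finset.sum_le_sum fun s _ =>
          (totalDegree_sub _ _).trans (max_le (totalDegree_X (R := K) i).le (by simp))
      _ = hS.toFinset.card := by simp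

/-- For `Σ` finite (and `σ` nonempty), `ω(Σ)` is attained by some nonzero polynomial vanishing on
`Σ`. [folklore] -/
theorem omegaDeg_spec [Nonempty σ] {S : Set (σ → K)} (hS : S.Finite) :
    ∃ P : MvPolynomial σ K, P ≠ 0 ∧ (∀ x ∈ S, eval x P = 0) ∧ P.totalDegree = omegaDeg S := by
  obtain ⟨P, hP, hv, -⟩ := exists_ne_zero_forall_eval_eq_zero hS
  exact Nat.sInf_mem (s := {n | ∃ P : MvPolynomial σ K, P ≠ 0 ∧ (∀ x ∈ S, eval x P = 0) ∧
    P.totalDegree = n}) ⟨P.totalDegree, P, hP, hv, rfl⟩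

/-- Characterisation of lower bounds for `ω(Σ)`, `Σ` finite: `k ≤ ω(Σ)` iff every nonzero
polynomial vanishing on `Σ` has total degree `≥ k`. [folklore] -/
theorem le_omegaDeg_iff [Nonempty σ] {S : Set (σ → K)} (hS : S.Finite) {k : ℕ} :
    k ≤ omegaDeg S ↔
      ∀ P : MvPolynomial σ K, P ≠ 0 → (∀ x ∈ S, eval x P = 0) → k ≤ P.totalDegree := by
  constructor
  · exact fun hk P hP hv => hk.trans (omegaDeg_le_totalDegree hP hv)
  · intro h
    obtain ⟨P, hP, hv, hdeg⟩ := omegaDeg_spec hS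
    exact hdeg ▸ h P hP hv

/-! ### Substitutions of degree `≤ 1` -/

/-- Substituting for each variable a polynomial of total degree `≤ 1` (e.g. a variable or a
constant) does not increase the total degree. [folklore] -/
theorem totalDegree_bind₁_le_of_le_one {τ : Type*} {f : σ → MvPolynomial τ K}
    (hf : ∀ i, (f i).totalDegree ≤ 1) (P : MvPolynomial σ K) :
    (bind₁ f P).totalDegree ≤ P.totalDegree := by
  classical
  conv_lhs => rw [P.as_sum]
  rw [map_sum]
  refine totalDegree_finsetSum_le fun d hd => ?_
  rw [bind₁_monomial]
  refine (totalDegree_mul _ _).trans ?_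
  rw [totalDegree_C, zero_add]
  refine (totalDegree_finsetProd _ _).trans ?_
  calc ∑ i ∈ d.support, (f i ^ d i).totalDegree
      ≤ ∑ i ∈ d.support, d i := Finset.sum_le_sum fun i _ =>
        calc (f i ^ d i).totalDegree ≤ d i * (f i).totalDegree := totalDegree_pow _ _
          _ ≤ d i * 1 := Nat.mul_le_mul_left _ (hf i)
          _ = d i := mul_one _
    _ = d.sum fun _ e => e := rfl
    _ ≤ P.totalDegree := le_totalDegree hd

/-! ### Cartesian products (Lemma 3.7) -/

variable {ι τ : Type*} {L : Type*}

/-- The product `Σ₁ × ⋯ × Σ_k ⊂ (L^τ)^ι = L^{ι × τ}` of the sets `S h ⊆ L^τ`, `h : ι`: the points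
`z` all of whose blocks `i ↦ z (h, i)` lie in the corresponding `S h`. [folklore] -/
def piBlocks (S : ι → Set (τ → L)) : Set (ι × τ → L) :=
  {z | ∀ h, (fun i => z (h, i)) ∈ S h}

/-- Membership in `piBlocks`. [folklore] -/
@[simp] theorem mem_piBlocks {S : ι → Set (τ → L)} {z : ι × τ → L} :
    z ∈ piBlocks S ↔ ∀ h, (fun i => z (h, i)) ∈ S h := Iff.rfl

/-- A product of finitely many finite sets is finite. [folklore] -/
theorem piBlocks_finite [Finite ι] {S : ι → Set (τ → L)} (hS : ∀ h, (S h).Finite) :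
    (piBlocks S).Finite := by
  have hpi : (Set.univ.pi S).Finite := Set.Finite.pi fun h => hS h
  refine (hpi.image fun f : ι → τ → L => fun p : ι × τ => f p.1 p.2).subset ?_
  intro z hz
  refine ⟨fun h i => z (h, i), ?_, ?_⟩
  · simpa [Set.mem_univ_pi] using hz
  · rfl

/-- `ω(Σ₁ × ⋯ × Σ_k) ≤ ω(Σ_{h₀})` for each block `h₀` (the easy half of Lemma 3.7: pull a minimal
polynomial for `Σ_{h₀}` back to the variables of block `h₀`).
[cite: NesterenkoPhilippon2001, Ch. 14 Lemma 3.7 (first half of the proof), pp. 254–255] -/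
theorem omegaDeg_piBlocks_le [Nonempty τ] (S : ι → Set (τ → K)) (hS : ∀ h, (S h).Finite)
    (h₀ : ι) : omegaDeg (piBlocks S) ≤ omegaDeg (S h₀) := by
  obtain ⟨P, hP, hv, hdeg⟩ := omegaDeg_spec (hS h₀)
  have hinj : Function.Injective fun i : τ => (h₀, i) := fun i j hij => congrArg Prod.snd hij
  have hQ : rename (fun i : τ => (h₀, i)) P ≠ 0 := (rename_injective _ hinj).ne hP
  calc omegaDeg (piBlocks S) ≤ (rename (fun i : τ => (h₀, i)) P).totalDegree :=
        omegaDeg_le_totalDegree hQ fun z hz => by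
          rw [eval_rename]
          exact hv _ (hz h₀)
    _ ≤ P.totalDegree := totalDegree_rename_le _ _
    _ = omegaDeg (S h₀) := hdeg

/-- The substantial half of Lemma 3.7: a nonzero polynomial vanishing on `Σ₁ × ⋯ × Σ_k` has total
degree `≥ min_h ω(Σ_h)` (over an infinite field). Peeling argument: free the blocks one at a time;
a specialisation in the variables of one block of degree `< ω(Σ_a)` vanishing on `Σ_a` is zero.
[cite: NesterenkoPhilippon2001, Ch. 14 Lemma 3.7 (second half of the proof), p. 255] -/
theorem iInf_omegaDeg_le_totalDegree [Fintype ι] [Infinite K] (S : ι → Set (τ → K))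
    {P : MvPolynomial (ι × τ) K} (hP : P ≠ 0) (hv : ∀ z ∈ piBlocks S, eval z P = 0) :
    ⨅ h, omegaDeg (S h) ≤ P.totalDegree := by
  classical
  by_contra hlt
  push Not at hlt
  have hlt' : ∀ h, P.totalDegree < omegaDeg (S h) := fun h =>
    hlt.trans_le (ciInf_le (OrderBot.bddBelow _) h)
  apply hP
  -- Substituting the block `a` of a point `w` by `y`.
  let subst : (ι × τ → K) → ι → (τ → K) → (ι × τ → K) :=
    fun w a y p => if p.1 = a then y p.2 else w p
  have subst_self : ∀ (w : ι × τ → K) (a : ι), subst w a (fun i => w (a, i)) = w := by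
    intro w a
    funext p
    by_cases hp : p.1 = a
    · simp only [subst, if_pos hp]
      rw [← hp]
    · simp only [subst, if_neg hp]
  -- `P` vanishes on the larger sets `T_s = {w ; ∀ h ∉ s, block h of w ∈ S h}`, by induction on `s`.
  have key : ∀ (s : Finset ι) (w : ι × τ → K), (∀ h, h ∉ s → (fun i => w (h, i)) ∈ S h) →
      eval w P = 0 := by
    intro s
    induction s using Finset.induction_on with
    | empty => exact fun w hw => hv w fun h => hw h (Finset.notMem_empty h)
    | insert a s ha ih =>
      intro w hw
      -- Specialise all blocks but `a` to the values of `w`; keep block `a` as variables.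
      let f : ι × τ → MvPolynomial τ K := fun p => if p.1 = a then X p.2 else C (w p)
      have hf : ∀ p, (f p).totalDegree ≤ 1 := by
        intro p
        by_cases hp : p.1 = a
        · simp only [f, if_pos hp]
          exact (totalDegree_X (R := K) p.2).le
        · simp only [f, if_neg hp, totalDegree_C]
          exact zero_le_one
      have hevalR : ∀ y : τ → K, eval y (bind₁ f P) = eval (subst w a y) P := by
        intro y
        rw [show eval y (bind₁ f P) = eval (fun p => eval y (f p)) P from
          eval₂Hom_bind₁ _ _ _ _]
        have hfun : (fun p => eval y (f p)) = subst w a y := by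
          funext p
          by_cases hp : p.1 = a
          · simp only [f, subst, if_pos hp, eval_X]
          · simp only [f, subst, if_neg hp, eval_C]
        rw [hfun]
      -- The specialisation vanishes on `S a` (induction hypothesis) and has degree `< ω(S a)`.
      have hRv : ∀ y ∈ S a, eval y (bind₁ f P) = 0 := by
        intro y hy
        rw [hevalR]
        refine ih _ fun h hh => ?_
        by_cases hha : h = a
        · subst hha
          simpa [subst] using hy
        · have hh' : h ∉ insert a s := by simp [hh, hha]
          have := hw h hh'
          simpa [subst, hha] using this
      have hR0 : bind₁ f P = 0 := by
        by_contra hR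
        exact ((totalDegree_bind₁_le_of_le_one hf P).trans_lt (hlt' a)).not_ge
          (omegaDeg_le_totalDegree hR hRv)
      -- Hence `P(w) = 0`.
      have := hevalR fun i => w (a, i)
      rw [hR0, map_zero, subst_self] at this
      exact this.symm
  exact MvPolynomial.funext fun w => by
    rw [map_zero]
    exact key Finset.univ w fun h hh => absurd (Finset.mem_univ h) hh

/-- **Lemma 3.7** (Nesterenko–Philippon (eds.) 2001, Ch. 14): for finite subsets
`Σ₁, …, Σ_k` of `Kⁿ` (`K` an infinite field, e.g. `ℂ`; `k ≥ 1`, `n ≥ 1`),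
`ω(Σ₁ × ⋯ × Σ_k) = min_h ω(Σ_h)`. [cite: NesterenkoPhilippon2001, Ch. 14 Lemma 3.7 p. 254] -/
theorem omegaDeg_piBlocks [Fintype ι] [Nonempty ι] [Nonempty τ] [Infinite K]
    (S : ι → Set (τ → K)) (hS : ∀ h, (S h).Finite) :
    omegaDeg (piBlocks S) = ⨅ h, omegaDeg (S h) := by
  refine le_antisymm ?_ ?_
  · obtain ⟨h₀, hh₀⟩ := exists_eq_ciInf_of_finite (f := fun h => omegaDeg (S h))
    rw [← hh₀]
    exact omegaDeg_piBlocks_le S hS h₀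
  · haveI : Nonempty (ι × τ) := inferInstance
    exact (le_omegaDeg_iff (piBlocks_finite hS)).mpr fun P hP hv =>
      iInf_omegaDeg_le_totalDegree S hP hv

end Literature.NumberTheory.Transcendental

end
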